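import Summits.BirchSwinnertonDyer.BirchSwinnertonDyer.Theorems.AlignedTransportAtTwoMainConjectureOfRankZeroBSDAtTwoSexticTowerRank
import Summits.BirchSwinnertonDyer.BirchSwinnertonDyer.Theorems.AlignedTransportAtTwoMainConjectureOfRankZeroBSDAtTwoZpTowerRankAnyPrime
import Literature.NumberTheory.IwasawaTheory.Fukuda1994Thm1RankProofs
import Literature.NumberTheory.IwasawaTheory.ClassGroupPRankCoinvariantCriterion
import HarnessLib

/-!
# Route `AlignedTransportAtTwo`, crux C2 `MainConjectureOfRankZeroBSDAtTwo` (stmt-BirchSwinnertonDyer-22298):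
# FUKUDA PROPAGATION ALONG THE `ℤ_p`-TOWER — a RANK certificate `r_{n+1} = r_n` freezes the rank, so it inherits EVERY deep-layer genus bound:
# `m ≤ r_n + 1 + u_K`; on the Kilford sub-cell the sextic `ℚ(W[2])` needs `r_n ≥ 3` at EVERY pair (also `(0,1)`), and the coinvariant door (L12, `c ≤ 1`)
# is VOID there at every pair

HONEST FRAMING (cell `bsd-f1-sign2`, WIDTH-5 attached prover seat `bsd-line-att-p3` gen 28, line `birth`, lead `bsd-line-att-p2`; `--supports`
stmt-BirchSwinnertonDyer-22298, closes nothing; BSD is NOT proved; crux C2, its verdict «blocked-on `Rank1Residual.GreenbergMuConjectureIrreducible`» and every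
registered stub (P / T / Kμ / LimDoor / MuIneqʳ / PFμ⁺) untouched).  THEOREMS ONLY — no definition, no named fact, no `sorry`.  Sequel of this seat's g27
`…SexticTowerRank` (p756164: `m·n ≤ n·rank₂ Cl(K_n) + n + n·u_K + log₂ #μ(K)`; sextic ON the stratum: `r_1 ≥ 2`, `r_n ≥ 3` for `n ≥ 2`) and `…ZpTowerRankAnyPrime`
(p756545, any `p`), now combined with two PROVED tree theorems of cell bsd-potss: Fukuda 1994 Thm. 1 (2) at finite level
(`fukuda1994_thm1_classGroupPRank_const_of_succ_eq_holds`: `r_{n+1} = r_n`, `n ≥ n₀` ⟹ `r_m = r_n ∀ m ≥ n` and `μ = 0`) and the coinvariant criterion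
(`classGroupPRank_le_of_coinvariant_index_le`: coinvariant index `≤ p^c`, `c < p^i`, at `(n+i, n+i+1)` ⟹ `r_{n+k} ≤ c` for EVERY `k`).

* §1 FUKUDA PROPAGATION, `p = 2`, any base `K` with `√2 ∈ K_1`, all places above `2` of odd index, `m ≤ #{w ∣ 2}` (Fukuda index `0`,
  `totallyRamifiedFrom_zero_of_sq_eq_two`): a certificate `r_{n+1} = r_n` at ANY pair `(n, n+1)`, `n ≥ 0`, gives `m·N ≤ N·r_n + N + N·u_K + log₂ #μ(K)` for every
  `N ≥ max(n,1)` (`mul_le_mul_classGroupPRank_add_of_rankCert`), hence ★ **`m ≤ r_n + 1 + u_K`** (`le_classGroupPRank_add_of_rankCert`, NO hypothesis on `#μ`: the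
  frozen rank is read at a layer deeper than `log₂ #μ`); `θ`-free and `K → ℚ₂` Galois forms.
* §2 the same for ANY prime `p` under `TotallyRamifiedFrom κ 0` (`le_classGroupPRank_add_of_rankCert_of_totallyRamifiedFrom`).
* §3 WHICH COINVARIANT DOORS CAN FIRE: the coinvariant criterion at `(n+i, n+i+1)` with `c < p^i` forces `r ≤ c` at all deep layers, so it can hold only if
  **`m ≤ c + 1 + u_K`** (`le_add_of_coinvariant_index_le`, any `p`; `p = 2` form); door L12 (`i = 1`, `c ≤ p − 1`) needs `m ≤ p + u_K`.
* §4 THE SEXTIC `T = ℚ(W[2])` ON THE KILFORD STRATUM (`Δ_W < 0`, no rational `2`-torsion abscissa; `m = 6`, `u = 2`), every cyclotomic `ℤ₂`-extension: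
  ★ **`three_le_classGroupPRank_of_rankCert_divisionField_two`** — a `2`-RANK certificate `r_{n+1} = r_n` at ANY pair needs **`r_n ≥ 3`**, in particular
  ★ **`three_le_classGroupPRank_zero_of_rankCert_zero`**: a layer-`(0,1)` certificate needs **`rank₂ Cl(ℚ(W[2])) ≥ 3`** (g27 / REF1 R296b had `≥ 2`); the certificate
  freezes all ranks (`classGroupPRank_eq_of_rankCert_divisionField_two`), gives `μ = 0` and hence `λ ≥ 3` (`three_le_classicalLambda_of_rankCert_divisionField_two`, with g26
  p753117); ★ **`not_coinvariant_index_le_divisionField_two`** — the coinvariant criterion / door L12 with `c ≤ 1` at the pair `(n+1, n+2)` is VOID for EVERY `n`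
  (it would give `rank₂ Cl(T_{n+2}) ≤ 1`); only `i ≥ 2`, `c = 3` could ever fire (`three_le_of_coinvariant_index_le_divisionField_two`).  `Δ_min ≡ 1 (mod 8)` forms.

READING (C2 input ledger / -data).  The only admissible `μ`-certificate on the Kilford sub-cell's sextic carrier is `2`-rank stabilisation (g26/R280c); THIS GEN:
its value is `≥ 3` at EVERY pair, so the CENSUS ASK becomes «`rank₂ Cl(ℚ(W[2])) ≥ 3`?» for the 12 certified seeds (where `≤ 2`, the degree-6/12 pair is
certificate-free and the first possible rung is `(T_1, T_2)`, degrees 12/24, with `r_1 = r_2 ≥ 3`); and door L12 of cell bsd-2adic never applies to the sextic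
(g27 successor (b) settled: no extremal case survives, `#μ(T_1)` irrelevant).  Nothing here is specific to BSD; no class group is computed.
References: [Fukuda1994] Thm. 1 (2), p. 264; [Washington1997] §13.3 Lemma 13.18, Prop. 13.22–13.23; [Gras2003] IV.4; [Lang1990] Ch. 13 §4 L4.1–4.2;
[NeukirchANT1999] Ch. II §8.
-/

set_option linter.dupNamespace false
set_option autoImplicit false

noncomputable section
open scoped Classical NumberField nonZeroDivisors
namespace Summit.BirchSwinnertonDyer.BirchSwinnertonDyer.Theorems.AlignedTransportAtTwoSexticRankCertificate

open NumberField IsDedekindDomain WeierstrassCurve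
open Literature.NumberTheory.EllipticCurves.Greenberg1999 Summit.BirchSwinnertonDyer.Rank1Residual.F1Sign2
open Literature.NumberTheory.NumberFields Literature.NumberTheory.GaloisRepresentations
  Literature.NumberTheory.IwasawaTheory Literature.NumberTheory.EllipticCurves
  Summit.BirchSwinnertonDyer.BirchSwinnertonDyer.Theorems.AlignedTransportAtTwoZpTowerChevalleyGrowth
  Summit.BirchSwinnertonDyer.BirchSwinnertonDyer.Theorems.AlignedTransportAtTwoSexticTowerGrowth
  Summit.BirchSwinnertonDyer.BirchSwinnertonDyer.Theorems.AlignedTransportAtTwoSexticTowerLambda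
  Summit.BirchSwinnertonDyer.BirchSwinnertonDyer.Theorems.AlignedTransportAtTwoSexticTowerRank
  Summit.BirchSwinnertonDyer.BirchSwinnertonDyer.Theorems.AlignedTransportAtTwoZpTowerRankAnyPrime

/-! ## §1 Fukuda propagation, `p = 2`: a rank certificate inherits every deep-layer genus bound -/

section TwoTower

variable {K : Type} [Field K] [NumberField K]

/-- **Fukuda index `0` from `√2 ∈ K_1` and odd indices above `2`**: every place above `2` ramifies in `K_1`, so every ramified prime is totally ramified
in `K_∞/K` (`TotallyRamifiedFrom κ 0`). [cite: Washington1997, §13.1 Lemma 13.3] [cite: Fukuda1994, p. 264 (the index `n₀`)] -/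
theorem totallyRamifiedFrom_zero_of_sq_eq_two (κ : ZpExtension K 2) {θ₁ : κ.layer 1} (hθ₁ : θ₁ ^ 2 = 2)
    (hodd : ∀ w : HeightOneSpectrum (𝓞 K), ((2 : ℕ) : 𝓞 K) ∈ w.asIdeal → Odd (w.asIdeal.ramificationIdx ℤ)) :
    TotallyRamifiedFrom κ 0 :=
  totallyRamifiedFrom_zero_of_forall_not_isUnramifiedIn_layer_one κ fun w hw =>
    not_isUnramifiedIn_layer_one_of_sq_eq_two κ hθ₁ hw (hodd w hw)

/-- **A rank certificate freezes the rank** (Fukuda 1994 Thm. 1 (2), tree-proved, at index `0`): `r_{n+1} = r_n` ⟹ `r_N = r_n` for every `N ≥ n`, and `μ = 0`.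
[cite: Fukuda1994, Thm. 1 (2), p. 264] -/
theorem classGroupPRank_eq_of_rankCert (κ : ZpExtension K 2) {θ₁ : κ.layer 1} (hθ₁ : θ₁ ^ 2 = 2)
    (hodd : ∀ w : HeightOneSpectrum (𝓞 K), ((2 : ℕ) : 𝓞 K) ∈ w.asIdeal → Odd (w.asIdeal.ramificationIdx ℤ))
    {n : ℕ} (hcert : classGroupPRank κ (n + 1) = classGroupPRank κ n) :
    (∀ N, n ≤ N → classGroupPRank κ N = classGroupPRank κ n) ∧ ClassicalMuVanishes κ :=
  haveI : Fact (Nat.Prime 2) := ⟨Nat.prime_two⟩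
  fukuda1994_thm1_classGroupPRank_const_of_succ_eq_holds K 2 κ 0 (totallyRamifiedFrom_zero_of_sq_eq_two κ hθ₁ hodd) n (Nat.zero_le n) hcert

/-- **Fukuda propagation, tower form.**  `κ` a `ℤ₂`-extension of `K` with `√2 ∈ K_1`, all places above `2` of odd index, `m ≤ #{w ∣ 2}`; a RANK certificate
`r_{n+1} = r_n` at the pair `(n, n+1)` (any `n ≥ 0`).  Then for EVERY `N ≥ n`, `N ≥ 1`: **`m·N ≤ N·r_n + N + N·u_K + log₂ #μ(K)`** — g27's tower bound
(p756164) at layer `N`, with `r_N = r_n` by Fukuda. [cite: Fukuda1994, Thm. 1 (2), p. 264] [cite: Gras2003, IV.4] -/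
theorem mul_le_mul_classGroupPRank_add_of_rankCert (κ : ZpExtension K 2) {θ₁ : κ.layer 1} (hθ₁ : θ₁ ^ 2 = 2)
    (hodd : ∀ w : HeightOneSpectrum (𝓞 K), ((2 : ℕ) : 𝓞 K) ∈ w.asIdeal → Odd (w.asIdeal.ramificationIdx ℤ))
    {m : ℕ} (hm : m ≤ {w : HeightOneSpectrum (𝓞 K) | ((2 : ℕ) : 𝓞 K) ∈ w.asIdeal}.ncard)
    {n : ℕ} (hcert : classGroupPRank κ (n + 1) = classGroupPRank κ n) {N : ℕ} (hnN : n ≤ N) (hN : 1 ≤ N) :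
    m * N ≤ N * classGroupPRank κ n + (N + N * Units.rank K + Nat.log 2 (Units.torsionOrder K)) := by
  have h := mul_le_mul_classGroupPRank_layer_add κ hθ₁ hodd hm hN
  rw [(classGroupPRank_eq_of_rankCert κ hθ₁ hodd hcert).1 N hnN] at h
  exact h

/-- ★ **Fukuda propagation: `m ≤ r_n + 1 + u_K` under a rank certificate at ANY pair `(n, n+1)`** — no hypothesis on `#μ(K)` (read the frozen rank at the
layer `N = n + log₂ #μ(K) + 1`).  For `K → ℚ₂` Galois of degree `d` with `4 ∤ d`: `d ≤ r_n + 1 + u_K`. [cite: Fukuda1994, Thm. 1 (2), p. 264] [cite: Gras2003, IV.4]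
[cite: Washington1997, §13.3 Prop. 13.22–13.23] -/
theorem le_classGroupPRank_add_of_rankCert (κ : ZpExtension K 2) {θ₁ : κ.layer 1} (hθ₁ : θ₁ ^ 2 = 2)
    (hodd : ∀ w : HeightOneSpectrum (𝓞 K), ((2 : ℕ) : 𝓞 K) ∈ w.asIdeal → Odd (w.asIdeal.ramificationIdx ℤ))
    {m : ℕ} (hm : m ≤ {w : HeightOneSpectrum (𝓞 K) | ((2 : ℕ) : 𝓞 K) ∈ w.asIdeal}.ncard)
    {n : ℕ} (hcert : classGroupPRank κ (n + 1) = classGroupPRank κ n) :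
    m ≤ classGroupPRank κ n + 1 + Units.rank K := by
  set c := Nat.log 2 (Units.torsionOrder K) with hc
  have h := mul_le_mul_classGroupPRank_add_of_rankCert κ hθ₁ hodd hm hcert (N := n + c + 1) (by omega) (by omega)
  by_contra hlt
  have hle : (classGroupPRank κ n + Units.rank K + 2) * (n + c + 1) ≤ m * (n + c + 1) := Nat.mul_le_mul_right _ (by omega)
  have hexp : (classGroupPRank κ n + Units.rank K + 2) * (n + c + 1) =
      (n + c + 1) * classGroupPRank κ n + (n + c + 1) * Units.rank K + 2 * (n + c + 1) := by ring
  omega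

/-- `θ`-free form: `4 ∤ [K:ℚ]`, `κ` cyclotomic, odd indices above `2`, `m ≤ #{w ∣ 2}`, certificate `r_{n+1} = r_n` ⟹ `m ≤ r_n + 1 + u_K`.
[cite: Fukuda1994, Thm. 1 (2), p. 264] [cite: Gras2003, IV.4] -/
theorem le_classGroupPRank_add_of_rankCert_of_not_four_dvd (h4 : ¬ 4 ∣ Module.finrank ℚ K) (κ : ZpExtension K 2) (hκ : κ.IsCyclotomic)
    (hodd : ∀ w : HeightOneSpectrum (𝓞 K), ((2 : ℕ) : 𝓞 K) ∈ w.asIdeal → Odd (w.asIdeal.ramificationIdx ℤ))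
    {m : ℕ} (hm : m ≤ {w : HeightOneSpectrum (𝓞 K) | ((2 : ℕ) : 𝓞 K) ∈ w.asIdeal}.ncard)
    {n : ℕ} (hcert : classGroupPRank κ (n + 1) = classGroupPRank κ n) :
    m ≤ classGroupPRank κ n + 1 + Units.rank K := by
  obtain ⟨θ₁, hθ₁⟩ := exists_sq_eq_two_layer_one_of_forall_sq_ne_two h4 (forall_sq_ne_two_of_forall_odd_ramificationIdx hodd) κ hκ
  exact le_classGroupPRank_add_of_rankCert κ hθ₁ hodd hm hcert

/-- **`K → ℚ₂`, Galois form**: `K/ℚ` Galois, `4 ∤ [K:ℚ]`, a ring map `K → ℚ₂`, `κ` cyclotomic, certificate `r_{n+1} = r_n` at any pair ⟹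
**`[K:ℚ] ≤ r_n + 1 + u_K`**. [cite: Fukuda1994, Thm. 1 (2), p. 264] [cite: NeukirchANT1999, Ch. II §8] [cite: Gras2003, IV.4] -/
theorem finrank_le_classGroupPRank_add_of_rankCert_of_ringHom_padic [IsGalois ℚ K] (h4 : ¬ 4 ∣ Module.finrank ℚ K) (σ₀ : K →+* ℚ_[2])
    (κ : ZpExtension K 2) (hκ : κ.IsCyclotomic) {n : ℕ} (hcert : classGroupPRank κ (n + 1) = classGroupPRank κ n) :
    Module.finrank ℚ K ≤ classGroupPRank κ n + 1 + Units.rank K := by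
  haveI : Fact (Nat.Prime 2) := ⟨Nat.prime_two⟩
  have hodd := forall_odd_ramificationIdx_of_isGalois_of_ringHom_padic (p := 2) σ₀
  have hm : Module.finrank ℚ K ≤ {w : HeightOneSpectrum (𝓞 K) | ((2 : ℕ) : 𝓞 K) ∈ w.asIdeal}.ncard :=
    (ncard_eq_finrank_of_isGalois_of_ringHom_padic (p := 2) σ₀).ge
  exact le_classGroupPRank_add_of_rankCert_of_not_four_dvd h4 κ hκ hodd hm hcert

end TwoTower

/-! ## §2 Fukuda propagation, any prime `p`, Fukuda index `0` -/

section AnyPrime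

variable {K : Type} [Field K] [NumberField K] {p : ℕ} [hp : Fact p.Prime]

/-- ★ **Any `p`: `m ≤ r_n + 1 + u_K` under a rank certificate at ANY pair.**  `κ` a `ℤ_p`-extension with `TotallyRamifiedFrom κ 0`, `m` at most the number of
primes of `K` ramified in `K_N` for every `N ≥ 1` (e.g. `m` totally ramified places), certificate `r_{n+1} = r_n` (`n ≥ 0`): the frozen rank (Fukuda) read at the
layer `N = n + log_p #μ(K) + 1` through p756545's `m·N ≤ N·r_N + N + N·u_K + log_p #μ(K)`. [cite: Fukuda1994, Thm. 1 (2), p. 264] [cite: Gras2003, IV.4]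
[cite: Washington1997, §13.3 Prop. 13.22–13.23] -/
theorem le_classGroupPRank_add_of_rankCert_of_totallyRamifiedFrom (κ : ZpExtension K p) (hram : TotallyRamifiedFrom κ 0) {m : ℕ}
    (hm : ∀ N : ℕ, 1 ≤ N → haveI : FiniteDimensional K (κ.layer N) := κ.finiteDimensional_layer_holds N
      m ≤ {w : HeightOneSpectrum (𝓞 K) | w.asIdeal.ramificationIdxIn (𝓞 (κ.layer N)) ≠ 1}.ncard)
    {n : ℕ} (hcert : classGroupPRank κ (n + 1) = classGroupPRank κ n) :
    m ≤ classGroupPRank κ n + 1 + Units.rank K := by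
  set c := Nat.log p (Units.torsionOrder K) with hc
  have hconst := (fukuda1994_thm1_classGroupPRank_const_of_succ_eq_holds K p κ 0 hram n (Nat.zero_le n) hcert).1 (n + c + 1) (by omega)
  have h := mul_le_mul_classGroupPRank_layer_add_of_totallyRamifiedFrom κ hram (n + c + 1) (hm (n + c + 1) (by omega))
  rw [hconst] at h
  by_contra hlt
  have hle : (classGroupPRank κ n + Units.rank K + 2) * (n + c + 1) ≤ m * (n + c + 1) := Nat.mul_le_mul_right _ (by omega)
  have hexp : (classGroupPRank κ n + Units.rank K + 2) * (n + c + 1) =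
      (n + c + 1) * classGroupPRank κ n + (n + c + 1) * Units.rank K + 2 * (n + c + 1) := by ring
  omega

/-- Any `p`: a rank certificate freezes the rank and gives `μ = 0` (Fukuda 1994 Thm. 1 (2) at index `0`, tree-proved; recorded for the readings below).
[cite: Fukuda1994, Thm. 1 (2), p. 264] -/
theorem classGroupPRank_eq_of_rankCert_of_totallyRamifiedFrom (κ : ZpExtension K p) (hram : TotallyRamifiedFrom κ 0)
    {n : ℕ} (hcert : classGroupPRank κ (n + 1) = classGroupPRank κ n) :
    (∀ N, n ≤ N → classGroupPRank κ N = classGroupPRank κ n) ∧ ClassicalMuVanishes κ :=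
  fukuda1994_thm1_classGroupPRank_const_of_succ_eq_holds K p κ 0 hram n (Nat.zero_le n) hcert

end AnyPrime

/-! ## §3 Which coinvariant doors can fire: `m ≤ c + 1 + u_K` is necessary -/

section Doors

variable {K : Type} [Field K] [NumberField K] {p : ℕ} [hp : Fact p.Prime]

/-- ★ **The coinvariant criterion (cell bsd-potss door L12 family) can fire only if `m ≤ c + 1 + u_K`.**  `κ` with `TotallyRamifiedFrom κ 0`, `m` at most the
number of primes ramified in `K_N` for all `N ≥ 1`; IF at the pair `(n+i, n+i+1)` the subgroup `Cl^p·⟨σx·x⁻¹⟩` of `Cl(K_{n+i+1})` has index `≤ p^c` with `c < p^i`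
(so `r_{n+k} ≤ c` for every `k`, tree `classGroupPRank_le_of_coinvariant_index_le`) THEN `m ≤ c + 1 + u_K` (genus theory at the deep layer `n + log_p #μ + 1`).
[cite: Washington1997, §13.3 Prop. 13.22–13.23] [cite: Fukuda1994, Thm. 1 (proof, p. 264)] [cite: Gras2003, IV.4] -/
theorem le_add_of_coinvariant_index_le (κ : ZpExtension K p) (hram : TotallyRamifiedFrom κ 0) {m : ℕ}
    (hm : ∀ N : ℕ, 1 ≤ N → haveI : FiniteDimensional K (κ.layer N) := κ.finiteDimensional_layer_holds N
      m ≤ {w : HeightOneSpectrum (𝓞 K) | w.asIdeal.ramificationIdxIn (𝓞 (κ.layer N)) ≠ 1}.ncard)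
    {n i c : ℕ} (hc : c < p ^ i)
    (hco : ((powMonoidHom p : ClassGroup (𝓞 (κ.layer (n + (i + 1)))) →* ClassGroup (𝓞 (κ.layer (n + (i + 1))))).range ⊔
        Subgroup.closure {x | ∃ (σ : (κ.layer (n + (i + 1))) ≃ₐ[K] (κ.layer (n + (i + 1))))
          (_ : ∀ y : κ.layer (n + (i + 1)), ((y : κ.layer (n + (i + 1))) : AlgebraicClosure K) ∈ κ.layer (n + i) → σ y = y)
          (x' : ClassGroup (𝓞 (κ.layer (n + (i + 1))))), x = ClassGroup.mulEquiv (AmbiguousClass.intAut σ) x' * x'⁻¹}).index ≤ p ^ c) :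
    m ≤ c + 1 + Units.rank K := by
  set d := Nat.log p (Units.torsionOrder K) with hd
  -- read the rank at the deep layer `N = n + (d + 1)`: `r_N ≤ c`
  have hrank := classGroupPRank_le_of_coinvariant_index_le κ hram (Nat.zero_le n) hc hco (d + 1)
  have h := mul_le_mul_classGroupPRank_layer_add_of_totallyRamifiedFrom κ hram (n + (d + 1)) (hm (n + (d + 1)) (by omega))
  by_contra hlt
  have hle : (c + Units.rank K + 2) * (n + (d + 1)) ≤ m * (n + (d + 1)) := Nat.mul_le_mul_right _ (by omega)
  have hexp : (c + Units.rank K + 2) * (n + (d + 1)) = (n + (d + 1)) * c + (n + (d + 1)) * Units.rank K + 2 * (n + (d + 1)) := by ring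
  have hmul : (n + (d + 1)) * classGroupPRank κ (n + (d + 1)) ≤ (n + (d + 1)) * c := Nat.mul_le_mul_left _ hrank
  omega

/-- **`p = 2` form** (`√2 ∈ K_1`, odd indices, `m ≤ #{w ∣ 2}`): the coinvariant criterion at `(n+i, n+i+1)` with `c < 2^i` can fire only if `m ≤ c + 1 + u_K`;
door L12 (`i = 1`, `c ≤ 1`) only if `m ≤ 2 + u_K`. [cite: Washington1997, §13.3 Prop. 13.22–13.23] [cite: Gras2003, IV.4] -/
theorem le_add_of_coinvariant_index_le_two (κ : ZpExtension K 2) {θ₁ : κ.layer 1} (hθ₁ : θ₁ ^ 2 = 2)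
    (hodd : ∀ w : HeightOneSpectrum (𝓞 K), ((2 : ℕ) : 𝓞 K) ∈ w.asIdeal → Odd (w.asIdeal.ramificationIdx ℤ))
    {m : ℕ} (hm : m ≤ {w : HeightOneSpectrum (𝓞 K) | ((2 : ℕ) : 𝓞 K) ∈ w.asIdeal}.ncard)
    {n i c : ℕ} (hc : c < 2 ^ i)
    (hco : ((powMonoidHom 2 : ClassGroup (𝓞 (κ.layer (n + (i + 1)))) →* ClassGroup (𝓞 (κ.layer (n + (i + 1))))).range ⊔
        Subgroup.closure {x | ∃ (σ : (κ.layer (n + (i + 1))) ≃ₐ[K] (κ.layer (n + (i + 1))))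
          (_ : ∀ y : κ.layer (n + (i + 1)), ((y : κ.layer (n + (i + 1))) : AlgebraicClosure K) ∈ κ.layer (n + i) → σ y = y)
          (x' : ClassGroup (𝓞 (κ.layer (n + (i + 1))))), x = ClassGroup.mulEquiv (AmbiguousClass.intAut σ) x' * x'⁻¹}).index ≤ 2 ^ c) :
    m ≤ c + 1 + Units.rank K := by
  haveI : Fact (Nat.Prime 2) := ⟨Nat.prime_two⟩
  have hram := totallyRamifiedFrom_zero_of_sq_eq_two κ hθ₁ hodd
  set d := Nat.log 2 (Units.torsionOrder K) with hd
  have hrank := classGroupPRank_le_of_coinvariant_index_le κ hram (Nat.zero_le n) hc hco (d + 1)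
  have h := mul_le_mul_classGroupPRank_layer_add κ hθ₁ hodd hm (n := n + (d + 1)) (by omega)
  by_contra hlt
  have hle : (c + Units.rank K + 2) * (n + (d + 1)) ≤ m * (n + (d + 1)) := Nat.mul_le_mul_right _ (by omega)
  have hexp : (c + Units.rank K + 2) * (n + (d + 1)) = (n + (d + 1)) * c + (n + (d + 1)) * Units.rank K + 2 * (n + (d + 1)) := by ring
  have hmul : (n + (d + 1)) * classGroupPRank κ (n + (d + 1)) ≤ (n + (d + 1)) * c := Nat.mul_le_mul_left _ hrank
  omega

end Doors

/-! ## §4 The sextic `ℚ(W[2])` ON the Kilford stratum: every rank certificate has value `≥ 3`; the coinvariant door with `c ≤ 1` is void -/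

section Sextic

open Summit.BirchSwinnertonDyer.BirchSwinnertonDyer.Theorems.AlignedTransportAtTwoKilfordStratumShared

variable (W : WeierstrassCurve ℚ) [W.IsElliptic]

/-- The sextic data: `4 ∤ 6`, all indices above `2` odd (`= 1`), `6 ≤ #{w ∣ 2}`, `u = 2`, and `√2 ∈ T_1` for every cyclotomic `κ`.
[cite: NeukirchANT1999, Ch. II §8] [cite: Washington1997, §13.1] -/
private theorem sextic_data' (ht : ∀ x : ℚ, ¬ HasRationalTwoTorsionX W x) (hΔ : W.Δ < 0) (hs : OnKilfordStratumAtTwo W)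
    (κ : ZpExtension (W.divisionField 2) 2) (hκ : κ.IsCyclotomic) :
    haveI : NumberField (W.divisionField 2) := NumberField.mk
    (∃ θ₁ : κ.layer 1, θ₁ ^ 2 = 2) ∧
    (∀ w : HeightOneSpectrum (𝓞 (W.divisionField 2)), ((2 : ℕ) : 𝓞 (W.divisionField 2)) ∈ w.asIdeal → Odd (w.asIdeal.ramificationIdx ℤ)) ∧
    6 ≤ {w : HeightOneSpectrum (𝓞 (W.divisionField 2)) | ((2 : ℕ) : 𝓞 (W.divisionField 2)) ∈ w.asIdeal}.ncard ∧
    Units.rank (W.divisionField 2) = 2 := by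
  haveI : NumberField (W.divisionField 2) := NumberField.mk
  have hsq : ¬ IsSquare W.Δ := fun ⟨r, hr⟩ ↦ by nlinarith [mul_self_nonneg r]
  have h4 : ¬ 4 ∣ Module.finrank ℚ (W.divisionField 2) := by rw [finrank_divisionField_two_eq_six W ht hsq]; decide
  have hodd : ∀ w : HeightOneSpectrum (𝓞 (W.divisionField 2)), ((2 : ℕ) : 𝓞 (W.divisionField 2)) ∈ w.asIdeal →
      Odd (w.asIdeal.ramificationIdx ℤ) := fun w hw ↦ by
    rw [(ramificationIdx_eq_one_and_inertiaDeg_eq_one_divisionField_two W hs w hw).1]; exact odd_one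
  exact ⟨exists_sq_eq_two_layer_one_of_forall_sq_ne_two h4 (forall_sq_ne_two_of_forall_odd_ramificationIdx hodd) κ hκ, hodd,
    (ncard_primes_divisionField_two_eq_six W ht hsq hs).ge, units_rank_divisionField_two W ht hΔ⟩

/-- **Fukuda index `0` for the sextic ON the stratum**: every cyclotomic `ℤ₂`-extension of `ℚ(W[2])` is totally ramified at its six dyadic primes from layer `0`.
[cite: Washington1997, §13.1 Lemma 13.3] [cite: Fukuda1994, p. 264] -/
theorem totallyRamifiedFrom_zero_divisionField_two (ht : ∀ x : ℚ, ¬ HasRationalTwoTorsionX W x) (hΔ : W.Δ < 0) (hs : OnKilfordStratumAtTwo W)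
    (κ : ZpExtension (W.divisionField 2) 2) (hκ : κ.IsCyclotomic) :
    haveI : NumberField (W.divisionField 2) := NumberField.mk
    TotallyRamifiedFrom κ 0 := by
  haveI : NumberField (W.divisionField 2) := NumberField.mk
  obtain ⟨⟨θ₁, hθ₁⟩, hodd, -, -⟩ := sextic_data' W ht hΔ hs κ hκ
  exact totallyRamifiedFrom_zero_of_sq_eq_two κ hθ₁ hodd

/-- **A rank certificate on the sextic freezes all ranks and gives `μ = 0`** (Fukuda Thm. 1 (2), tree-proved, index `0`).
[cite: Fukuda1994, Thm. 1 (2), p. 264] -/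
theorem classGroupPRank_eq_of_rankCert_divisionField_two (ht : ∀ x : ℚ, ¬ HasRationalTwoTorsionX W x) (hΔ : W.Δ < 0)
    (hs : OnKilfordStratumAtTwo W) (κ : ZpExtension (W.divisionField 2) 2) (hκ : κ.IsCyclotomic)
    {n : ℕ} (hcert : classGroupPRank κ (n + 1) = classGroupPRank κ n) :
    (∀ N, n ≤ N → classGroupPRank κ N = classGroupPRank κ n) ∧ ClassicalMuVanishes κ := by
  haveI : NumberField (W.divisionField 2) := NumberField.mk
  haveI : Fact (Nat.Prime 2) := ⟨Nat.prime_two⟩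
  exact fukuda1994_thm1_classGroupPRank_const_of_succ_eq_holds _ 2 κ 0 (totallyRamifiedFrom_zero_divisionField_two W ht hΔ hs κ hκ) n
    (Nat.zero_le n) hcert

/-- ★ **EVERY `2`-rank certificate on the sextic has value `≥ 3`.**  `W` with no rational `2`-torsion abscissa, `Δ_W < 0`, ON the Kilford stratum; `κ` any
cyclotomic `ℤ₂`-extension of `T = ℚ(W[2])`; IF `rank₂ Cl(T_{n+1}) = rank₂ Cl(T_n)` for some `n ≥ 0` THEN **`rank₂ Cl(T_n) ≥ 3`** (the frozen rank equals
`rank₂ Cl(T_{n+2}) ≥ 3`, g27). [cite: Fukuda1994, Thm. 1 (2), p. 264] [cite: Gras2003, IV.4] -/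
theorem three_le_classGroupPRank_of_rankCert_divisionField_two (ht : ∀ x : ℚ, ¬ HasRationalTwoTorsionX W x) (hΔ : W.Δ < 0)
    (hs : OnKilfordStratumAtTwo W) (κ : ZpExtension (W.divisionField 2) 2) (hκ : κ.IsCyclotomic)
    {n : ℕ} (hcert : classGroupPRank κ (n + 1) = classGroupPRank κ n) : 3 ≤ classGroupPRank κ n := by
  rw [← (classGroupPRank_eq_of_rankCert_divisionField_two W ht hΔ hs κ hκ hcert).1 (n + 2) (by omega)]
  exact three_le_classGroupPRank_layer_divisionField_two W ht hΔ hs κ hκ (by omega)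

/-- ★ **A layer-`(0,1)` certificate needs `rank₂ Cl(ℚ(W[2])) ≥ 3`** (sharpening g27's `≥ 2`, REF1 R296b): if `rank₂ Cl(ℚ(W[2])(√2)) = rank₂ Cl(ℚ(W[2]))` then
`rank₂ Cl(ℚ(W[2])) ≥ 3`.  CENSUS: a seed with `rank₂ Cl(ℚ(W[2])) ≤ 2` cannot certify at degrees `6/12`. [cite: Fukuda1994, Thm. 1 (2), p. 264] [cite: Gras2003, IV.4] -/
theorem three_le_classGroupPRank_zero_of_rankCert_zero (ht : ∀ x : ℚ, ¬ HasRationalTwoTorsionX W x) (hΔ : W.Δ < 0)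
    (hs : OnKilfordStratumAtTwo W) (κ : ZpExtension (W.divisionField 2) 2) (hκ : κ.IsCyclotomic)
    (hcert : classGroupPRank κ 1 = classGroupPRank κ 0) : 3 ≤ classGroupPRank κ 0 :=
  three_le_classGroupPRank_of_rankCert_divisionField_two W ht hΔ hs κ hκ (n := 0) hcert

/-- Contrapositive for the census: `rank₂ Cl(T_n) ≤ 2` ⟹ `rank₂ Cl(T_{n+1}) ≠ rank₂ Cl(T_n)` (no certificate at that pair).
[cite: Fukuda1994, Thm. 1 (2), p. 264] [cite: Gras2003, IV.4] -/
theorem classGroupPRank_succ_ne_of_le_two_divisionField_two (ht : ∀ x : ℚ, ¬ HasRationalTwoTorsionX W x) (hΔ : W.Δ < 0)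
    (hs : OnKilfordStratumAtTwo W) (κ : ZpExtension (W.divisionField 2) 2) (hκ : κ.IsCyclotomic)
    {n : ℕ} (hle : classGroupPRank κ n ≤ 2) : classGroupPRank κ (n + 1) ≠ classGroupPRank κ n := fun hcert ↦ by
  have := three_le_classGroupPRank_of_rankCert_divisionField_two W ht hΔ hs κ hκ hcert
  omega

/-- **A rank certificate on the sextic gives `μ = 0` AND `λ ≥ 3`** (Fukuda's rider + g26 `three_le_classicalLambda_divisionField_two`).
[cite: Fukuda1994, Thm. 1 (2), p. 264] [cite: Washington1997, §13.3 Thm. 13.13] -/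
theorem three_le_classicalLambda_of_rankCert_divisionField_two (ht : ∀ x : ℚ, ¬ HasRationalTwoTorsionX W x) (hΔ : W.Δ < 0)
    (hs : OnKilfordStratumAtTwo W) (κ : ZpExtension (W.divisionField 2) 2) (hκ : κ.IsCyclotomic)
    {n : ℕ} (hcert : classGroupPRank κ (n + 1) = classGroupPRank κ n) :
    ClassicalMuVanishes κ ∧ 3 ≤ classicalLambda κ :=
  have hμ := (classGroupPRank_eq_of_rankCert_divisionField_two W ht hΔ hs κ hκ hcert).2
  ⟨hμ, three_le_classicalLambda_divisionField_two W ht hΔ hs κ hκ hμ⟩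

/-- ★ **The coinvariant door with `c ≤ 1` is VOID on the sextic at EVERY pair.**  For every `n` and `c ≤ 1` the subgroup `Cl(T_{n+2})² · ⟨σx·x⁻¹ : σ ∈
Gal(T_{n+2}/ℚ(W[2])) fixing T_{n+1}⟩` of `Cl(T_{n+2})` has index `> 2^c` — i.e. the `Gal(T_{n+2}/T_{n+1})`-coinvariants of `Cl(T_{n+2})/2` have `2`-rank `≥ 2`
(else `rank₂ Cl(T_{n+2}) ≤ c ≤ 1` by the tree's coinvariant criterion, against `≥ 3`).  This is the hypothesis `hco` of
`classicalMuVanishes_of_coinvariant_index_le_succ_succ` (Fukuda index `n`), through which door L12 (`classicalMuVanishes_of_genus_bound_layer_succ_succ`,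
`classicalMuVanishes_of_rank_add_le_layer_succ_succ`, `p = 2`, `c ≤ 1`) concludes: that door never applies to `ℚ(W[2])`.
[cite: Washington1997, §13.3 Prop. 13.22–13.23] [cite: Fukuda1994, Thm. 1 (proof, p. 264)] [cite: Gras2003, IV.4] -/
theorem not_coinvariant_index_le_divisionField_two (ht : ∀ x : ℚ, ¬ HasRationalTwoTorsionX W x) (hΔ : W.Δ < 0)
    (hs : OnKilfordStratumAtTwo W) (κ : ZpExtension (W.divisionField 2) 2) (hκ : κ.IsCyclotomic) (n : ℕ) {c : ℕ} (hc : c ≤ 1) :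
    haveI : NumberField (W.divisionField 2) := NumberField.mk
    ¬ ((powMonoidHom 2 : ClassGroup (𝓞 (κ.layer (n + (1 + 1)))) →* ClassGroup (𝓞 (κ.layer (n + (1 + 1))))).range ⊔
        Subgroup.closure {x | ∃ (σ : (κ.layer (n + (1 + 1))) ≃ₐ[W.divisionField 2] (κ.layer (n + (1 + 1))))
          (_ : ∀ y : κ.layer (n + (1 + 1)), ((y : κ.layer (n + (1 + 1))) : AlgebraicClosure (W.divisionField 2)) ∈ κ.layer (n + 1) → σ y = y)
          (x' : ClassGroup (𝓞 (κ.layer (n + (1 + 1))))), x = ClassGroup.mulEquiv (AmbiguousClass.intAut σ) x' * x'⁻¹}).index ≤ 2 ^ c := by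
  haveI : NumberField (W.divisionField 2) := NumberField.mk
  haveI : Fact (Nat.Prime 2) := ⟨Nat.prime_two⟩
  intro hco
  have hram := totallyRamifiedFrom_zero_divisionField_two W ht hΔ hs κ hκ
  have hc' : c < 2 ^ 1 := by rw [pow_one]; omega
  have hrank := classGroupPRank_le_of_coinvariant_index_le κ hram (Nat.zero_le n) hc' hco 2
  have h3 := three_le_classGroupPRank_layer_divisionField_two W ht hΔ hs κ hκ (n := n + 2) (by omega)
  omega

/-- **Only `c ≥ 3` coinvariant doors could ever fire on the sextic**: if at some pair `(n+i, n+i+1)` the coinvariant index is `≤ 2^c` with `c < 2^i`, then `3 ≤ c`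
(so `i ≥ 2`: pairs `(T_{n+2}, T_{n+3})` and deeper, degrees `≥ 24/48`). [cite: Washington1997, §13.3 Prop. 13.22–13.23] [cite: Gras2003, IV.4] -/
theorem three_le_of_coinvariant_index_le_divisionField_two (ht : ∀ x : ℚ, ¬ HasRationalTwoTorsionX W x) (hΔ : W.Δ < 0)
    (hs : OnKilfordStratumAtTwo W) (κ : ZpExtension (W.divisionField 2) 2) (hκ : κ.IsCyclotomic) {n i c : ℕ} (hc : c < 2 ^ i)
    (hco : haveI : NumberField (W.divisionField 2) := NumberField.mk
      ((powMonoidHom 2 : ClassGroup (𝓞 (κ.layer (n + (i + 1)))) →* ClassGroup (𝓞 (κ.layer (n + (i + 1))))).range ⊔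
        Subgroup.closure {x | ∃ (σ : (κ.layer (n + (i + 1))) ≃ₐ[W.divisionField 2] (κ.layer (n + (i + 1))))
          (_ : ∀ y : κ.layer (n + (i + 1)), ((y : κ.layer (n + (i + 1))) : AlgebraicClosure (W.divisionField 2)) ∈ κ.layer (n + i) → σ y = y)
          (x' : ClassGroup (𝓞 (κ.layer (n + (i + 1))))), x = ClassGroup.mulEquiv (AmbiguousClass.intAut σ) x' * x'⁻¹}).index ≤ 2 ^ c) :
    3 ≤ c := by
  haveI : NumberField (W.divisionField 2) := NumberField.mk
  haveI : Fact (Nat.Prime 2) := ⟨Nat.prime_two⟩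
  have hram := totallyRamifiedFrom_zero_divisionField_two W ht hΔ hs κ hκ
  have hrank := classGroupPRank_le_of_coinvariant_index_le κ hram (Nat.zero_le n) hc hco 2
  have h3 := three_le_classGroupPRank_layer_divisionField_two W ht hΔ hs κ hκ (n := n + 2) (by omega)
  omega

variable [W.IsGloballyMinimal]

/-- The `Δ_min ≡ 1 (mod 8)` form (globally minimal `W`, good ordinary at `2`) of «every rank certificate has value `≥ 3`». [cite: Fukuda1994, Thm. 1 (2), p. 264]
[cite: Serre1973, Ch. II §3.3 Thm. 4] -/
theorem three_le_classGroupPRank_of_rankCert_divisionField_two_of_minimalDiscriminantInt_emod_eight (hord : IsOrdinaryAt W 2)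
    (ht : ∀ x : ℚ, ¬ HasRationalTwoTorsionX W x) (hΔ : W.Δ < 0) (h8 : minimalDiscriminantInt W % 8 = 1)
    (κ : ZpExtension (W.divisionField 2) 2) (hκ : κ.IsCyclotomic) {n : ℕ} (hcert : classGroupPRank κ (n + 1) = classGroupPRank κ n) :
    3 ≤ classGroupPRank κ n :=
  three_le_classGroupPRank_of_rankCert_divisionField_two W ht hΔ ((onKilfordStratumAtTwo_iff_minimalDiscriminantInt_emod_eight W hord).mpr h8) κ hκ hcert

/-- The `Δ_min ≡ 1 (mod 8)` form of «the coinvariant door with `c ≤ 1` is void at every pair». [cite: Washington1997, §13.3 Prop. 13.22–13.23]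
[cite: Serre1973, Ch. II §3.3 Thm. 4] -/
theorem not_coinvariant_index_le_divisionField_two_of_minimalDiscriminantInt_emod_eight (hord : IsOrdinaryAt W 2)
    (ht : ∀ x : ℚ, ¬ HasRationalTwoTorsionX W x) (hΔ : W.Δ < 0) (h8 : minimalDiscriminantInt W % 8 = 1)
    (κ : ZpExtension (W.divisionField 2) 2) (hκ : κ.IsCyclotomic) (n : ℕ) {c : ℕ} (hc : c ≤ 1) :
    haveI : NumberField (W.divisionField 2) := NumberField.mk
    ¬ ((powMonoidHom 2 : ClassGroup (𝓞 (κ.layer (n + (1 + 1)))) →* ClassGroup (𝓞 (κ.layer (n + (1 + 1))))).range ⊔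
        Subgroup.closure {x | ∃ (σ : (κ.layer (n + (1 + 1))) ≃ₐ[W.divisionField 2] (κ.layer (n + (1 + 1))))
          (_ : ∀ y : κ.layer (n + (1 + 1)), ((y : κ.layer (n + (1 + 1))) : AlgebraicClosure (W.divisionField 2)) ∈ κ.layer (n + 1) → σ y = y)
          (x' : ClassGroup (𝓞 (κ.layer (n + (1 + 1))))), x = ClassGroup.mulEquiv (AmbiguousClass.intAut σ) x' * x'⁻¹}).index ≤ 2 ^ c :=
  not_coinvariant_index_le_divisionField_two W ht hΔ ((onKilfordStratumAtTwo_iff_minimalDiscriminantInt_emod_eight W hord).mpr h8) κ hκ n hc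

end Sextic

end Summit.BirchSwinnertonDyer.BirchSwinnertonDyer.Theorems.AlignedTransportAtTwoSexticRankCertificate
end
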